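import Summits.Ventures.Crystal3D.Kissing125.GSearchCheck1
import HarnessLib

/-!
# The growth-search checker (computable part), κ-generic — part 2/2

HONEST FRAMING (cell pub-crystal3d, K-path at `h = 5/4`, V4 = κ as an explicit parameter): this is NOT a result printed
by Hales; it is his METHOD (arXiv:1209.6043, Theorem 3 + Lemmas 7–10, in the tree's form of a verified interval-arithmetic
growth search, `Literature/…/KissingSearch*.lean`) with the largest long-side cosine `κ` made an EXPLICIT PARAMETER
(`κ : Kappa`, carrying the two numeric facts the soundness proof uses: `-1/2 ≤ κ`, `κ < 1/4`).  Only the declarations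
whose statement depends on `κ` are declared here (namespace `…Kissing125.GSearch`, the tree's short names, no renames);
every κ-free helper is the landed K25 copy (`…Kissing125.KissingSearch.*`) and every κ-free lemma is cited from the tree
(PRIVATE per-file citation aliases; `GSearchTransport.lean` holds `toT : St → tree St` and the transport equalities).  The K25
instance is `κ25 = ⟨7/32, …⟩`; `GSearchBridge.lean` identifies the generic checker at
`κ25` with the landed `Kissing125.KissingSearch.checkPart`, so the landed run files are consumed unchanged.  Generated by
`HOME/lean/kissing125/v4-prep/gen/mkgen.py`; nothing here is asserted about GAP(1.26) or any census.

THIS FILE: the κ-tainted declarations of `Literature/Geometry/DiscreteGeometry/KissingSearchCheck.lean` (part 2 of 2), with `κ : Kappa` threaded; κ-free declarations of that file are NOT re-declared publicly (the κ-free helpers are the landed K25 copies; the κ-free tree lemmas used by the proofs are cited through PRIVATE aliases at the top of the file).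

## References
* T. C. Hales, *A proof of Fejes Tóth's conjecture on sphere packings with kissing number twelve*,
  arXiv:1209.6043 (2012): Definition 1, Theorem 2, Theorem 3, Lemmas 7–10. [`Hales2012`]
* R. E. Moore, *Interval Analysis* (1966), Theorem 3.1, §4.4. [`Moore1966`]
-/

namespace Summit.Ventures.Crystal3D.Kissing125

open Literature.Geometry.DiscreteGeometry
open Summit.Ventures.Crystal3D.Kissing125.KissingSearch

namespace GSearch

open Real Literature.Analysis.ValidatedNumerics KissingLP NonemptyInterval Finset

/-- Expand every node of a list one level: `none` if a leaf is `false`; decided `true` leaves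
disappear; internal nodes are replaced by their children. [folklore] -/
def stepAll (κ : Kappa) : List (St × List ℕ) → Option (List (St × List ℕ))
  | [] => some []
  | p :: rest =>
    match St.expand κ p.1 p.2 with
    | .leaf true => stepAll κ rest
    | .leaf false => none
    | .branch kids => (stepAll κ rest).map fun L => kids ++ L

/-- The frontier at depth `k`. [folklore] -/
def frontier (κ : Kappa) (L : List (St × List ℕ)) : ℕ → Option (List (St × List ℕ))
  | 0 => some L
  | k + 1 =>
    match stepAll κ L with
    | none => none
    | some L' => frontier κ L' k

/-- **Part `i` of `parts` of the whole computation**: the nodes of the frontier at depth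
`depth` whose index is `≡ i (mod parts)` are searched with fuel `fuel`. [folklore] -/
def checkPart (κ : Kappa) (depth parts i fuel : ℕ) : Bool :=
  match frontier κ rootStates depth with
  | none => false
  | some L => (indexed L).all fun p => p.1 % parts != i || St.search κ p.2.1 p.2.2 fuel

/-- The whole computation in one piece (for reference; the run is split into parts).
[folklore] -/
def checkAll (κ : Kappa) (fuel : ℕ) : Bool := rootStates.all fun p => St.search κ p.1 p.2 fuel

/-- The K25 parameter `κ = 7/32 = 1 − (5/4)²/2` as a `Kappa`. [cite: Hales2012, Definition 1] -/
def κ25 : Kappa := ⟨7 / 32, by norm_num, by norm_num⟩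


end GSearch

end Summit.Ventures.Crystal3D.Kissing125
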